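import Mathlib
import Summits.ValiantsHypothesis.ValiantsHypothesis.Theses.ValuativeGCT
import Summits.ValiantsHypothesis.ValiantsHypothesis.Theorems.ValuativeGCTValuativeBound
import Literature.Computability.AlgebraicComplexity.OrbitCoordinateRingProofs
import Literature.NumberTheory.DiophantineGeometry.SchurWeylPlethysmCoordRepWeightsProofs
import Literature.NumberTheory.DiophantineGeometry.SchurWeylPlethysmOrbitWeightsProofs

/-!
# `TailFlip` — negative lemma IV: evaluation certificates anchored inside `Δ(det_m)` certify nothing

Crux `stmt-ValiantsHypothesis-15687` (`Theses.ValuativeGCT.TailFlip`, route ValuativeGCT, rev 4), for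
the picked line `Sketch` (isobaric anchors; stub `stub_isobaricTailCensus` asks for an evaluation
certificate of size `D` beating the valuative census `dim T_U(λ) < D`).  Standing disprover (cdisprove
cycle 1, 2026-08-16), `Cruxes/TailFlip/Disproof.lean` §1.

* `le_orbitMultiplicity_of_det_ne_zero'` — the certificate bridge (highest-weight vectors with a
  nonsingular evaluation matrix at points of the zero locus of `I(GL · f)` give
  `D ≤ orbitMultiplicity ℂ f N χ`), restated over Literature lemmas (it is
  `ValuativeFlip.le_orbitMultiplicity_of_det_ne_zero` of `Theorems/ValuativeGCTValuativeFlipCertificateBridge`,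
  whose module was not built on the farm when this file was written);
* `certificate_le_finrank_of_mem_orbitClosure` — at `f = det_m` and weight `λ*`, with the PROVED
  `ValuativeBound` (`K_m(λ*) ≤ dim T_U(λ)`, `ValuativeBound_proof`): a nonsingular certificate at points
  of `Δ(det_m)` gives `D ≤ dim T_U(λ)` for EVERY admissible centre `(U, r)` — it can never witness a
  census inequality; so census witnesses need evaluation points OUTSIDE `Δ(det_m)`;
* `certificate_le_finrank_of_endDet` — in particular for anchors that are `End`-points of `det_m`
  (`aeval_formCoeff_eq_zero_of_mem_orbitVanishingIdeal`: `I(GL · f)` vanishes at every `B · f`), e.g.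
  padded anchors with an affine determinantal expression of size `≤ m`; for the isobaric anchors
  `X₀₀^j x_t^i (A · per_K)` this is the case once `j ≥ 2^K - 1 - K` (Grenet block), so anchors must have
  size `K > log₂ (j + K + 1)`.

Sources: Mulmuley–Sohoni 2001 §4–5; BLMW 2011 (arXiv:0907.2850) §4.4, §5.2; Bürgisser–Ikenmeyer
STOC 2013 §2; Grenet 2011. [folklore]
-/

-- `Summit.ValiantsHypothesis.ValiantsHypothesis.…` repeats a component by the D-0017 layout
-- (single-conjunct summit), which the `dupNamespace` linter flags; the name is mandated.
set_option linter.dupNamespace false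

namespace Summit.ValiantsHypothesis.ValiantsHypothesis.Theorems.TailFlip.Negative

open Literature.NumberTheory.DiophantineGeometry Literature.Computability.AlgebraicComplexity
open Summit.ValiantsHypothesis.ValiantsHypothesis.Theses.ValuativeGCT
open Summit.ValiantsHypothesis.ValiantsHypothesis.Theorems.ValuativeBound

/-- An element of `I(GL · f)` vanishes at `B · f` for EVERY matrix `B` (singular allowed):
`I(GL · f)` is the kernel of the generic orbit map (`orbitVanishingIdeal_eq_ker_genericOrbitMap`,
`aeval_genericOrbitMap`; `GL` is Zariski dense in `Mat`). [folklore] -/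
theorem aeval_formCoeff_eq_zero_of_mem_orbitVanishingIdeal {m N : ℕ} (f : MvPolynomial (MatIdx m) ℂ)
    {G : MvPolynomial (DegIdx (MatIdx m) N) ℂ} (hG : G ∈ orbitVanishingIdeal f N)
    (B : Matrix (MatIdx m) (MatIdx m) ℂ) :
    MvPolynomial.aeval (formCoeff N (linSubst (MatIdx m) ℂ B f)) G = 0 := by
  rw [orbitVanishingIdeal_eq_ker_genericOrbitMap, RingHom.mem_ker] at hG
  have h1 := aeval_genericOrbitMap f N G B
  rw [hG, map_zero] at h1
  exact h1.symm

/-- **Certificate bridge** (= `ValuativeFlip.le_orbitMultiplicity_of_det_ne_zero` of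
`Theorems/ValuativeGCTValuativeFlipCertificateBridge`, restated over Literature lemmas only because
that module is not built on the farm at the time of writing): highest-weight vectors `F₁ … F_D` of
weight `χ` in `ℂ[Sym^N ℂ^σ]` with a NONSINGULAR evaluation matrix at points `p_l` of the zero locus of
`I(GL · f)` give `D ≤ orbitMultiplicity ℂ f N χ` (`N ≠ 0`). [folklore] -/
theorem le_orbitMultiplicity_of_det_ne_zero' {m N : ℕ} (hN : N ≠ 0) (f : MvPolynomial (MatIdx m) ℂ)
    (χ : Weight (MatIdx m)) {D : ℕ} (F : Fin D → MvPolynomial (DegIdx (MatIdx m) N) ℂ)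
    (hF : ∀ i, F i ∈ highestWeightSpace (coordRep (MatIdx m) ℂ N) χ)
    (p : Fin D → (DegIdx (MatIdx m) N → ℂ))
    (hp : ∀ j, ∀ G ∈ orbitVanishingIdeal f N, MvPolynomial.aeval (p j) G = 0)
    (hdet : (Matrix.of fun i j : Fin D => MvPolynomial.aeval (p j) (F i)).det ≠ 0) :
    D ≤ orbitMultiplicity ℂ f N χ := by
  classical
  haveI := finiteDimensional_highestWeightSpace_orbitCoordRep_holds (k := ℂ) f hN χ
  have hM : LinearIndependent ℂ (fun i : Fin D => fun j : Fin D => MvPolynomial.aeval (p j) (F i)) :=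
    Matrix.linearIndependent_rows_of_det_ne_zero hdet
  have hli : LinearIndependent ℂ
      (fun i => Ideal.Quotient.mkₐ ℂ (orbitVanishingIdeal f N) (F i)) := by
    rw [Fintype.linearIndependent_iff] at hM ⊢
    intro c hc i
    refine hM c ?_ i
    have hmem : ∑ i, c i • F i ∈ orbitVanishingIdeal f N := by
      rw [← Ideal.Quotient.eq_zero_iff_mem, ← Ideal.Quotient.mkₐ_eq_mk ℂ, map_sum]
      simpa only [map_smul] using hc
    funext j
    have h0 := hp j _ hmem
    rw [map_sum] at h0
    simp only [map_smul, smul_eq_mul] at h0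
    simpa only [Finset.sum_apply, Pi.smul_apply, smul_eq_mul, Pi.zero_apply] using h0
  set W := highestWeightSpace (orbitCoordRep f N) χ with hW
  let y : Fin D → W := fun i =>
    ⟨Ideal.Quotient.mkₐ ℂ (orbitVanishingIdeal f N) (F i),
      mk_mem_highestWeightSpace_orbitCoordRep f (hF i)⟩
  have hy : LinearIndependent ℂ y := LinearIndependent.of_comp W.subtype hli
  have h := hy.fintype_card_le_finrank
  rw [Fintype.card_fin] at h
  unfold orbitMultiplicity hwMultiplicity
  exact h

/-- **Certificates anchored inside `Δ(det_m)` certify nothing against the census** (for the line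
`Sketch`, stub `stub_isobaricTailCensus`).  Let `F₁ … F_D` be highest-weight vectors of weight `λ*`
in `ℂ[Sym^m ℂ^{m²}]` and `p₁ … p_D` points of the orbit CLOSURE `Δ(det_m)` (zeros of `I(GL · det_m)`).
If the evaluation matrix `(F_i(p_l))` is nonsingular then `D ≤ dim T_U(λ)` for EVERY admissible centre
`(U, r)`: `D ≤ K_m(λ*)` by the certificate bridge at `f = det_m`, and `K_m(λ*) ≤ dim T_U(λ)` is
`ValuativeBound_proof`.  So a census witness `dim T_U(λ) < D` with an evaluation certificate forces
some evaluation point OUTSIDE `Δ(det_m)`. -/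
theorem certificate_le_finrank_of_mem_orbitClosure (m : ℕ) [NeZero m] {δ : ℕ}
    (lam : Nat.Partition (m * δ)) (hcard : lam.parts.card ≤ m * m)
    (D : ℕ) (F : Fin D → MvPolynomial (DegIdx (MatIdx m) m) ℂ)
    (hF : ∀ i, F i ∈ highestWeightSpace (coordRep (MatIdx m) ℂ m)
      ((Weight.dualOfPartition (m * m) lam).toMatIdx : Weight (MatIdx m)))
    (p : Fin D → (DegIdx (MatIdx m) m → ℂ))
    (hp : ∀ l, ∀ G ∈ orbitVanishingIdeal (detFormLex ℂ m) m, MvPolynomial.aeval (p l) G = 0)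
    (hdet : (Matrix.of fun i l : Fin D => MvPolynomial.aeval (p l) (F i)).det ≠ 0)
    (U : Submodule ℂ (MatIdx m → ℂ)) (r : ℕ)
    (hU : ∀ u ∈ U, (Matrix.of fun a b : Fin m => u (toLex (a, b))).rank ≤ r) :
    let χ : Literature.NumberTheory.DiophantineGeometry.Weight (Literature.NumberTheory.DiophantineGeometry.MatIdx m) := (Literature.NumberTheory.DiophantineGeometry.Weight.dualOfPartition (m * m) lam).toMatIdx; let T : Submodule ℂ (MvPolynomial (Literature.NumberTheory.DiophantineGeometry.MatIdx m × Literature.NumberTheory.DiophantineGeometry.MatIdx m) ℂ) := MvPolynomial.homogeneousSubmodule (Literature.NumberTheory.DiophantineGeometry.MatIdx m × Literature.NumberTheory.DiophantineGeometry.MatIdx m) ℂ (m * δ) ⊓ ((MvPolynomial.vanishingIdeal ℂ {p : Literature.NumberTheory.DiophantineGeometry.MatIdx m × Literature.NumberTheory.DiophantineGeometry.MatIdx m → ℂ | ∀ j : Literature.NumberTheory.DiophantineGeometry.MatIdx m, (fun i => p (j, i)) ∈ U}) ^ (δ * (m - r))).restrictScalars ℂ ⊓ (⨅ (M : Matrix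 (Literature.NumberTheory.DiophantineGeometry.MatIdx m) (Literature.NumberTheory.DiophantineGeometry.MatIdx m) ℂ) (_ : Literature.Computability.AlgebraicComplexity.linSubst (Literature.NumberTheory.DiophantineGeometry.MatIdx m) ℂ M (Literature.NumberTheory.DiophantineGeometry.detFormLex ℂ m) = Literature.NumberTheory.DiophantineGeometry.detFormLex ℂ m), LinearMap.ker ((MvPolynomial.aeval (R := ℂ) fun p : Literature.NumberTheory.DiophantineGeometry.MatIdx m × Literature.NumberTheory.DiophantineGeometry.MatIdx m => ∑ l : Literature.NumberTheory.DiophantineGeometry.MatIdx m, M l p.2 • MvPolynomial.X (p.1, l)).toLinearMap - LinearMap.id (R := ℂ) (M := MvPolynomial (Literature.NumberTheory.DiophantineGeometry.MatIdx m × Literature.NumberTheory.DiophantineGeometry.MatIdx m) ℂ))) ⊓ (⨅ (g : Matrix.GeneralLinearGroup (Literature.NumberTheory.DiophantineGeometry.MatIdx m) ℂ) (_ : Literature.NumberTheory.DiophantineGeometry.IsUpperTriangular g), LinearMap.ker ((MvPolynomial.aeval (R := ℂ) fun p : Literature.NumberTheory.DiophantineGeometry.MatIdx m × Literature.NumberTheory.DiophantineGeometry.MatIdx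 m => ∑ l : Literature.NumberTheory.DiophantineGeometry.MatIdx m, ((g⁻¹ : Matrix.GeneralLinearGroup (Literature.NumberTheory.DiophantineGeometry.MatIdx m) ℂ) : Matrix (Literature.NumberTheory.DiophantineGeometry.MatIdx m) (Literature.NumberTheory.DiophantineGeometry.MatIdx m) ℂ) p.1 l • MvPolynomial.X (l, p.2)).toLinearMap - Literature.NumberTheory.DiophantineGeometry.weightChar χ g • LinearMap.id (R := ℂ) (M := MvPolynomial (Literature.NumberTheory.DiophantineGeometry.MatIdx m × Literature.NumberTheory.DiophantineGeometry.MatIdx m) ℂ))); D ≤ Module.finrank ℂ ↥T := by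
  intro χ T
  exact (le_orbitMultiplicity_of_det_ne_zero' (NeZero.ne m) (detFormLex ℂ m) χ F hF p hp hdet).trans
    (ValuativeBound_proof m U r hU δ lam hcard)

/-- **In particular for anchors in `End · det_m`**: if the evaluation points are
`q_l = A_l · (X₀₀^(m-n) per_n)` AND ALSO `End`-points of the determinant, `q_l = B_l · det_m`
(e.g. they have affine determinantal expressions of size `≤ m`, homogenised), then a nonsingular
evaluation matrix gives `D ≤ dim T_U(λ)` for every admissible centre.  For the isobaric anchors
`X₀₀^j x_t^i (A · per_K)` of the picked line this happens as soon as `j ≥ dc(x_t^i · A·per_K) - K - i`,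
in particular (Grenet block ⊕ `x_t I_i`, `dc(per_K) ≤ 2^K - 1`) as soon as `j ≥ 2^K - 1 - K`: a
census witness needs anchors of size `K > log₂ (j + K + 1)`. -/
theorem certificate_le_finrank_of_endDet {n : ℕ} (m : ℕ) [NeZero m] {δ : ℕ}
    (lam : Nat.Partition (m * δ)) (hcard : lam.parts.card ≤ m * m)
    (D : ℕ) (F : Fin D → MvPolynomial (DegIdx (MatIdx m) m) ℂ)
    (hF : ∀ i, F i ∈ highestWeightSpace (coordRep (MatIdx m) ℂ m)
      ((Weight.dualOfPartition (m * m) lam).toMatIdx : Weight (MatIdx m)))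
    (A B : Fin D → Matrix (MatIdx m) (MatIdx m) ℂ)
    (hAB : ∀ l, linSubst (MatIdx m) ℂ (A l) (paddedPerFormLex ℂ n m) =
      linSubst (MatIdx m) ℂ (B l) (detFormLex ℂ m))
    (hdet : (Matrix.of fun i l : Fin D => MvPolynomial.aeval
      (formCoeff m (linSubst (MatIdx m) ℂ (A l) (paddedPerFormLex ℂ n m))) (F i)).det ≠ 0)
    (U : Submodule ℂ (MatIdx m → ℂ)) (r : ℕ)
    (hU : ∀ u ∈ U, (Matrix.of fun a b : Fin m => u (toLex (a, b))).rank ≤ r) :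
    let χ : Literature.NumberTheory.DiophantineGeometry.Weight (Literature.NumberTheory.DiophantineGeometry.MatIdx m) := (Literature.NumberTheory.DiophantineGeometry.Weight.dualOfPartition (m * m) lam).toMatIdx; let T : Submodule ℂ (MvPolynomial (Literature.NumberTheory.DiophantineGeometry.MatIdx m × Literature.NumberTheory.DiophantineGeometry.MatIdx m) ℂ) := MvPolynomial.homogeneousSubmodule (Literature.NumberTheory.DiophantineGeometry.MatIdx m × Literature.NumberTheory.DiophantineGeometry.MatIdx m) ℂ (m * δ) ⊓ ((MvPolynomial.vanishingIdeal ℂ {p : Literature.NumberTheory.DiophantineGeometry.MatIdx m × Literature.NumberTheory.DiophantineGeometry.MatIdx m → ℂ | ∀ j : Literature.NumberTheory.DiophantineGeometry.MatIdx m, (fun i => p (j, i)) ∈ U}) ^ (δ * (m - r))).restrictScalars ℂ ⊓ (⨅ (M : Matrix (Literature.NumberTheory.DiophantineGeometry.MatIdx m) (Literature.NumberTheory.DiophantineGeometry.MatIdx m) ℂ) (_ : Literature.Computability.AlgebraicComplexity.linSubst (Literature.NumberTheory.DiophantineGeometry.MatIdx m) ℂ M (Literature.NumberTheory.DiophantineGeometry.detFormLex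 ℂ m) = Literature.NumberTheory.DiophantineGeometry.detFormLex ℂ m), LinearMap.ker ((MvPolynomial.aeval (R := ℂ) fun p : Literature.NumberTheory.DiophantineGeometry.MatIdx m × Literature.NumberTheory.DiophantineGeometry.MatIdx m => ∑ l : Literature.NumberTheory.DiophantineGeometry.MatIdx m, M l p.2 • MvPolynomial.X (p.1, l)).toLinearMap - LinearMap.id (R := ℂ) (M := MvPolynomial (Literature.NumberTheory.DiophantineGeometry.MatIdx m × Literature.NumberTheory.DiophantineGeometry.MatIdx m) ℂ))) ⊓ (⨅ (g : Matrix.GeneralLinearGroup (Literature.NumberTheory.DiophantineGeometry.MatIdx m) ℂ) (_ : Literature.NumberTheory.DiophantineGeometry.IsUpperTriangular g), LinearMap.ker ((MvPolynomial.aeval (R := ℂ) fun p : Literature.NumberTheory.DiophantineGeometry.MatIdx m × Literature.NumberTheory.DiophantineGeometry.MatIdx m => ∑ l : Literature.NumberTheory.DiophantineGeometry.MatIdx m, ((g⁻¹ : Matrix.GeneralLinearGroup (Literature.NumberTheory.DiophantineGeometry.MatIdx m) ℂ) : Matrix (Literature.NumberTheory.DiophantineGeometry.MatIdx m) (Literature.NumberTheory.DiophantineGeometry.MatIdx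 m) ℂ) p.1 l • MvPolynomial.X (l, p.2)).toLinearMap - Literature.NumberTheory.DiophantineGeometry.weightChar χ g • LinearMap.id (R := ℂ) (M := MvPolynomial (Literature.NumberTheory.DiophantineGeometry.MatIdx m × Literature.NumberTheory.DiophantineGeometry.MatIdx m) ℂ))); D ≤ Module.finrank ℂ ↥T := by
  have hdet' : (Matrix.of fun i l : Fin D => MvPolynomial.aeval
      (formCoeff m (linSubst (MatIdx m) ℂ (B l) (detFormLex ℂ m))) (F i)).det ≠ 0 := by
    simpa only [hAB] using hdet
  exact certificate_le_finrank_of_mem_orbitClosure m lam hcard D F hF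
    (fun l => formCoeff m (linSubst (MatIdx m) ℂ (B l) (detFormLex ℂ m)))
    (fun l G hG => aeval_formCoeff_eq_zero_of_mem_orbitVanishingIdeal (detFormLex ℂ m) hG (B l))
    hdet' U r hU

end Summit.ValiantsHypothesis.ValiantsHypothesis.Theorems.TailFlip.Negative
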